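import Mathlib.AlgebraicTopology.AlternatingFaceMapComplex
import Mathlib.AlgebraicTopology.SingularSet
import Mathlib.CategoryTheory.Abelian.Ext
import Mathlib.Algebra.Homology.ShortComplex.ModuleCat
import Mathlib.Algebra.Homology.ConcreteCategory
import Mathlib.Topology.Homotopy.Equiv
import Summits.Ventures.HodgeRepro2.HostAPI.Carriers.AlgebraicTopology.SingularHomology.SingularChains
import Summits.Ventures.HodgeRepro2.HostAPI.Util.ForallBinderLint
open HostAPI.Carriers

noncomputable section

open CategoryTheory Limits AlgebraicTopology Simplicial Opposite

universe u v

namespace HostAPI.Carriers.AlgebraicTopology.SingularHomology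

variable (R : Type v) [CommRing R] (M : Type v) [AddCommGroup M] [Module R M]
variable {X Y Z : Type u} [TopologicalSpace X] [TopologicalSpace Y] [TopologicalSpace Z]

variable (X) in

def singularCochainCosimplicial : CosimplicialObject (ModuleCat.{max u v} R) where
  obj d := ModuleCat.of R ((TopCat.toSSet.obj (TopCat.of X)).obj (op d) → M)
  map f := ModuleCat.ofHom (LinearMap.funLeft R M ((TopCat.toSSet.obj (TopCat.of X)).map f.op))
  map_id d := by ext; simp
  map_comp f g := by ext; simp

namespace singularCochainCosimplicial

def map (f : C(X, Y)) :
    singularCochainCosimplicial R M Y ⟶ singularCochainCosimplicial R M X where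
  app d := ModuleCat.ofHom
    (LinearMap.funLeft R M ((TopCat.toSSet.map (TopCat.ofHom f)).app (op d)))
  naturality d e g := by
    ext φ
    funext σ
    change φ ((TopCat.toSSet.obj (TopCat.of Y)).map g.op
      ((TopCat.toSSet.map (TopCat.ofHom f)).app (op e) σ)) =
      φ ((TopCat.toSSet.map (TopCat.ofHom f)).app (op d)
        ((TopCat.toSSet.obj (TopCat.of X)).map g.op σ))
    rw [← NatTrans.naturality_apply]

end singularCochainCosimplicial

variable (X) in

def singularCochainComplex : CochainComplex (ModuleCat.{max u v} R) ℕ :=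
  (alternatingCofaceMapComplex _).obj (singularCochainCosimplicial R M X)

namespace singularCochainComplex

variable {R M} {n : ℕ}

@[ext]
lemma ext {φ ψ : (singularCochainComplex R M X).X n}
    (h : ∀ σ : SingularSimplex X n, φ σ = ψ σ) : φ = ψ :=
  funext h

@[simp]
lemma d_apply (φ : SingularSimplex X n → M) (σ : SingularSimplex X (n + 1)) :
    (singularCochainComplex R M X).d n (n + 1) φ σ =
      ∑ i : Fin (n + 2), ((-1 : R) ^ (i : ℕ)) • φ (σ.face i) := by
  have h : (singularCochainComplex R M X).d n (n + 1) =
      ∑ i : Fin (n + 2), (-1 : ℤ) ^ (i : ℕ) • (singularCochainCosimplicial R M X).δ i :=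
    CochainComplex.of_d (fun k ↦ (singularCochainCosimplicial R M X).obj ⦋k⦌)
      (AlternatingCofaceMapComplex.objD _) n
  rw [h]
  change (ModuleCat.Hom.hom (∑ i : Fin (n + 2),
    (-1 : ℤ) ^ (i : ℕ) • (singularCochainCosimplicial R M X).δ i :
      (singularCochainCosimplicial R M X).obj ⦋n⦌ ⟶
        (singularCochainCosimplicial R M X).obj ⦋n + 1⦌) φ) σ = _
  rw [ModuleCat.hom_sum, LinearMap.coe_sum, Finset.sum_apply]
  refine (Finset.sum_apply (M := fun _ ↦ M) σ Finset.univ _).trans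
    (Finset.sum_congr rfl fun i _ ↦ ?_)
  change ((-1 : ℤ) ^ (i : ℕ)) • φ (σ.face i) = _
  rw [← Int.cast_smul_eq_zsmul R, Int.cast_pow, Int.cast_neg, Int.cast_one]

variable (R M X n) in

abbrev cocycles : ModuleCat.{max u v} R := (singularCochainComplex R M X).cycles n

abbrev cocyclesMk (φ : SingularSimplex X n → M)
    (h : (singularCochainComplex R M X).d n (n + 1) φ = 0) : cocycles R M X n :=
  (singularCochainComplex R M X).cyclesMk φ (n + 1) (by simp) h

variable (R M X n) in

abbrev iCocycles : cocycles R M X n ⟶ (singularCochainComplex R M X).X n :=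
  (singularCochainComplex R M X).iCycles n

variable (R M X) in

abbrev toCocycles (i j : ℕ) : (singularCochainComplex R M X).X i ⟶ cocycles R M X j :=
  (singularCochainComplex R M X).toCycles i j

@[simp]
lemma iCocycles_mk (φ : SingularSimplex X n → M)
    (h : (singularCochainComplex R M X).d n (n + 1) φ = 0) :
    iCocycles R M X n (cocyclesMk φ h) = φ :=
  (singularCochainComplex R M X).i_cyclesMk (i := n) φ (n + 1) (by simp) h

variable (R M) in

def map (f : C(X, Y)) : singularCochainComplex R M Y ⟶ singularCochainComplex R M X :=
  (alternatingCofaceMapComplex _).map (singularCochainCosimplicial.map R M f)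

@[simp]
lemma map_apply (f : C(X, Y)) (φ : (singularCochainComplex R M Y).X n)
    (σ : SingularSimplex X n) : (map R M f).f n φ σ = φ (σ.map f) :=
  rfl

variable (R M) in

@[simp]
lemma map_id : map R M (ContinuousMap.id X) = 𝟙 _ := by
  ext n φ σ
  simp

variable (R M) in

lemma map_comp (f : C(X, Y)) (g : C(Y, Z)) :
    map R M (g.comp f) = map R M g ≫ map R M f := by
  ext n φ σ
  simp [SingularSimplex.map_comp]

end singularCochainComplex

variable (X) in

def singularCohomology (n : ℕ) : ModuleCat.{max u v} R :=
  (singularCochainComplex R M X).homology n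

namespace singularCohomology

variable (X) in

abbrev π (n : ℕ) : singularCochainComplex.cocycles R M X n ⟶ singularCohomology R M X n :=
  (singularCochainComplex R M X).homologyπ n

end singularCohomology

@[elab_as_elim]
theorem singularCohomology_induction_on {n : ℕ} {C : singularCohomology R M X n → Prop}
    (x : singularCohomology R M X n)
    (h : ∀ x : singularCochainComplex.cocycles R M X n, C (singularCohomology.π R M X n x)) :
    C x := by
  obtain ⟨y, rfl⟩ :=
    (ModuleCat.epi_iff_surjective ((singularCochainComplex R M X).homologyπ n)).1 inferInstance x
  exact h y

namespace singularCohomology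

abbrev map (f : C(X, Y)) (n : ℕ) : singularCohomology R M Y n ⟶ singularCohomology R M X n :=
  HomologicalComplex.homologyMap (singularCochainComplex.map R M f) n

@[simp]
lemma map_id (n : ℕ) : map R M (ContinuousMap.id X) n = 𝟙 _ := by
  change HomologicalComplex.homologyMap _ n = 𝟙 ((singularCochainComplex R M X).homology n)
  rw [singularCochainComplex.map_id, HomologicalComplex.homologyMap_id]

@[reassoc]
lemma map_comp (f : C(X, Y)) (g : C(Y, Z)) (n : ℕ) :
    map R M (g.comp f) n = map R M g n ≫ map R M f n := by
  change HomologicalComplex.homologyMap _ n =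
    HomologicalComplex.homologyMap _ n ≫ HomologicalComplex.homologyMap _ n
  rw [singularCochainComplex.map_comp, HomologicalComplex.homologyMap_comp]

def map_eq_of_homotopic : Prop :=
  ∀ {f g : C(X, Y)}, f.Homotopic g → ∀ n : ℕ, map R M f n = map R M g n

@[simps]
def mapIso (e : X ≃ₜ Y) (n : ℕ) : singularCohomology R M Y n ≅ singularCohomology R M X n where
  hom := map R M e n
  inv := map R M e.symm n
  hom_inv_id := by
    rw [← map_comp]
    exact (congrArg (map R M · n) (by ext x; exact e.apply_symm_apply x)).trans (map_id R M n)
  inv_hom_id := by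
    rw [← map_comp]
    exact (congrArg (map R M · n) (by ext x; exact e.symm_apply_apply x)).trans (map_id R M n)

@[simps]
def isoOfHomotopyEquiv
    (h : ∀ {X Y : Type u} [TopologicalSpace X] [TopologicalSpace Y],
      map_eq_of_homotopic R M (X := X) (Y := Y))
    (e : ContinuousMap.HomotopyEquiv X Y) (n : ℕ) :
    singularCohomology R M Y n ≅ singularCohomology R M X n where
  hom := map R M e.toFun n
  inv := map R M e.invFun n
  hom_inv_id := by rw [← map_comp, h e.right_inv, map_id]
  inv_hom_id := by rw [← map_comp, h e.left_inv, map_id]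

end singularCohomology

namespace singularCochainComplex

variable {R M} {n : ℕ}

def XIsoFun (g : SingularSimplex X n → M) :
    (singularChainComplex R R X).X n ⟶ ModuleCat.of R (ULift.{u} M) :=
  Sigma.desc fun σ : SingularSimplex X n ↦ ModuleCat.ofHom
    ((LinearMap.toSpanSingleton R (ULift.{u} M) (ULift.up (g σ))).comp
      ULift.moduleEquiv.toLinearMap)

@[simp]
lemma XIsoFun_single (g : SingularSimplex X n → M) (σ : SingularSimplex X n) (r : R) :
    XIsoFun (R := R) g (singularChainComplex.single (R := R) σ r) = ULift.up (r • g σ) := by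
  change (Sigma.ι (fun _ : SingularSimplex X n ↦ ModuleCat.of R (ULift.{u} R)) σ ≫
    XIsoFun (R := R) g) (ULift.up r) = _
  rw [XIsoFun, Sigma.ι_desc]
  rfl

def XIsoHom : (SingularSimplex X n → M) →ₗ[R]
    ((singularChainComplex R R X).X n ⟶ ModuleCat.of R (ULift.{u} M)) where
  toFun g := XIsoFun (R := R) g
  map_add' g g' := by
    refine singularChainComplex.hom_ext fun σ r ↦ ?_
    change _ = XIsoFun (R := R) g (singularChainComplex.single (R := R) σ r) +
      XIsoFun (R := R) g' (singularChainComplex.single (R := R) σ r)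
    rw [XIsoFun_single, XIsoFun_single, XIsoFun_single, Pi.add_apply, smul_add]
    rfl
  map_smul' c g := by
    refine singularChainComplex.hom_ext fun σ r ↦ ?_
    change _ = c • XIsoFun (R := R) g (singularChainComplex.single (R := R) σ r)
    rw [XIsoFun_single, XIsoFun_single, Pi.smul_apply, smul_comm r c]
    rfl

def XIsoInv : ((singularChainComplex R R X).X n ⟶ ModuleCat.of R (ULift.{u} M)) →ₗ[R]
    (SingularSimplex X n → M) where
  toFun f σ := (f (singularChainComplex.single (R := R) σ (1 : R))).down
  map_add' _ _ := rfl
  map_smul' _ _ := rfl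

variable (R M X n) in

def XIso : (singularCochainComplex R M X).X n ≅
    ModuleCat.of R ((singularChainComplex R R X).X n ⟶ ModuleCat.of R (ULift.{u} M)) where
  hom := ModuleCat.ofHom XIsoHom
  inv := ModuleCat.ofHom XIsoInv
  hom_inv_id := by
    ext g σ
    change (XIsoFun (R := R) g (singularChainComplex.single (R := R) σ (1 : R))).down = g σ
    rw [XIsoFun_single, one_smul]
  inv_hom_id := by
    ext f : 2
    change XIsoFun (R := R) (fun σ ↦ (f (singularChainComplex.single (R := R) σ (1 : R))).down) = f
    refine singularChainComplex.hom_ext fun σ r ↦ ?_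
    rw [XIsoFun_single]
    have h : singularChainComplex.single (R := R) σ r =
        r • singularChainComplex.single (R := R) σ (1 : R) := by
      rw [← singularChainComplex.singleₗ_apply, ← singularChainComplex.singleₗ_apply, ← map_smul,
        smul_eq_mul, mul_one]
    rw [h, map_smul]
    rfl

variable (R M X) in

def nonempty_iso_linearYonedaObj : Prop :=
  Nonempty (singularCochainComplex R M X ≅
      (singularChainComplex R R X).linearYonedaObj R (ModuleCat.of R (ULift.{u} M)))

end singularCochainComplex

def nonempty_singularCohomology_zero_equiv : Prop :=
  ∀ [PathConnectedSpace X],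
    Nonempty (singularCohomology R M X 0 ≃ₗ[R] M)

def isZero_singularCohomology_of_subsingleton : Prop :=
  ∀ [Subsingleton X] {n : ℕ}, n ≠ 0 → IsZero (singularCohomology R M X n)

end HostAPI.Carriers.AlgebraicTopology.SingularHomology
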